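import Literature.NumberTheory.IwasawaTheory.ZpExtensionNormKernelOnePrime
import Literature.NumberTheory.NumberFields.OneRamifiedPrimeTower
import Literature.NumberTheory.NumberFields.ClassGroupNormSurjective
import HarnessLib

/-!
# The norm between two layers `K_k ⊆ K_j` of a `ℤ_p`-extension with Fukuda index `0` over a field with one prime above `p` is ONTO the class group,
# and onto on `p`-primary parts: `A_j ↠ A_k` (`A = Cl[p^∞]`) — the transition maps of `X = lim_← A_k` (Washington §13.3)

Topic `NumberTheory/IwasawaTheory` (namespace = path).  THEOREM-ONLY file (no definition, no named fact, no `sorry`), written by the prover seat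
`bsd-wall-rtt-p4-w2` g20 (cell `bsd-wall`; `--supports` stmt-BirchSwinnertonDyer-21438, line `nonsquare-descent` stub S2; closes nothing; BSD is proved for no
curve here).  Companion of `ZpExtensionNormKernelLayerPair.lean` (the KERNEL of the same norm).  Any `Algebra (κ.layer k) (κ.layer j)` compatible with `K`
(`IsScalarTower K (κ.layer k) (κ.layer j)`) is allowed.

* `classGroupNorm_layer_layer_surjective` — `N_{K_j/K_k} : Cl(K_j) ↠ Cl(K_k)` (the prime of `K_j` above `p` is totally ramified over `K_k`:
  tree `exists_ramificationIdx_eq_pow_of_totallyRamifiedFrom_zero`, `ramificationIdx_eq_finrank_top`, `classGroupNorm_surjective_of_ramificationIdx_eq_finrank`).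
* `exists_primary_classGroupNorm_layer_layer_eq` — the `p`-primary form: a `p`-primary class of `K_k` is the norm of a `p`-primary class of `K_j`.

References: [Washington1997] Thm. 10.1 / Prop. 4.11 (remark), §13.3 proof of Thm. 13.13 (`X → A_n` onto); [Lang1990] Ch. 5 §1 p. 125.
-/

noncomputable section

open scoped NumberField
open NumberField IsDedekindDomain Field Ideal

namespace Literature.NumberTheory.IwasawaTheory

open Literature.NumberTheory.EllipticCurves Literature.NumberTheory.NumberFields
  Literature.NumberTheory.NumberFields.ClassGroupNormKernel

variable {K : Type} [Field K] [NumberField K] {p : ℕ} [hp : Fact p.Prime] (κ : ZpExtension K p)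

omit [NumberField K] hp in
/-- A surjection of finite commutative groups maps the `p`-primary part ONTO the `p`-primary part: a `p`-primary `b` (`b ^ p ^ m = 1`) has a `p`-primary
preimage (`a ^ p ^ s = 1`, `p ^ s ∥ #A`): `a = a₀ ^ (u v)` with `#A = p^s u`, `p ∤ u`, `u v ≡ 1 (mod p^m)`. [folklore] -/
private theorem exists_primary_preimage_of_surjective {A B : Type*} [CommGroup A] [Fintype A] [CommGroup B] (f : A →* B)
    (hf : Function.Surjective f) (hp' : p.Prime) {m : ℕ} {b : B} (hb : b ^ p ^ m = 1) :
    ∃ a : A, a ^ p ^ (Fintype.card A).factorization p = 1 ∧ f a = b := by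
  classical
  set h := Fintype.card A with hh
  have h0 : h ≠ 0 := Fintype.card_ne_zero
  set s := h.factorization p with hs
  set u := h / p ^ s with hu
  have hpu : Nat.Coprime u (p ^ m) := (Nat.coprime_ordCompl hp' h0).symm.pow_right m
  have hhu : p ^ s * u = h := Nat.ordProj_mul_ordCompl_eq_self h p
  obtain ⟨a₀, rfl⟩ := hf b
  rcases Nat.lt_or_ge 1 (p ^ m) with hm | hm
  · obtain ⟨v, -, hv⟩ := Nat.exists_mul_mod_eq_one_of_coprime hpu hm
    refine ⟨a₀ ^ (u * v), ?_, ?_⟩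
    · rw [← pow_mul, mul_comm (u * v), ← mul_assoc, hhu, pow_mul, hh, pow_card_eq_one, one_pow]
    · rw [map_pow]
      have huv : u * v = p ^ m * (u * v / p ^ m) + 1 := by
        have := Nat.div_add_mod (u * v) (p ^ m); rw [hv] at this; exact this.symm
      rw [huv, pow_add, pow_one, pow_mul, hb, one_pow, one_mul]
  · have hm1 : p ^ m = 1 := le_antisymm hm (Nat.one_le_iff_ne_zero.mpr (pow_ne_zero m hp'.ne_zero))
    rw [hm1, pow_one] at hb
    exact ⟨1, one_pow _, by rw [map_one, hb]⟩

variable {k j : ℕ} [Algebra (κ.layer k) (κ.layer j)] [IsScalarTower K (κ.layer k) (κ.layer j)]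

/-- **`N_{K_j/K_k} : Cl(K_j) → Cl(K_k)` is onto** (generic compatible algebra structure; `κ` with Fukuda index `0` over `K` with one prime above `p`:
the prime of `K_j` above `p` is totally ramified over `K_k`). [cite: Washington1997, Thm. 10.1 and Prop. 4.11, §13.3 (proof of Thm. 13.13)]
[cite: Lang1990, Ch. 5 §1 (p. 125)] -/
theorem classGroupNorm_layer_layer_surjective (hκ : TotallyRamifiedFrom κ 0)
    (v₀ : HeightOneSpectrum (𝓞 K)) (hv₀ : ∀ w : HeightOneSpectrum (𝓞 K), ((p : ℕ) : 𝓞 K) ∈ w.asIdeal → w = v₀)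
    [NumberField (κ.layer k)] [NumberField (κ.layer j)] :
    Function.Surjective (classGroupNorm (κ.layer k) (κ.layer j)) := by
  haveI : FiniteDimensional K (κ.layer k) := κ.finiteDimensional_layer_holds k
  haveI : FiniteDimensional K (κ.layer j) := κ.finiteDimensional_layer_holds j
  haveI : IsGalois K (κ.layer k) := κ.isGalois_layer_holds k
  haveI : IsGalois K (κ.layer j) := κ.isGalois_layer_holds j
  obtain ⟨𝔓', h𝔓'max, h𝔓', -⟩ := exists_ramificationIdx_eq_pow_of_totallyRamifiedFrom_zero κ j hκ v₀ hv₀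
  haveI := h𝔓'max
  have hfin : 𝔓'.ramificationIdx (𝓞 K) = Module.finrank K (κ.layer j) := by rw [h𝔓', κ.finrank_layer_holds j]
  exact classGroupNorm_surjective_of_ramificationIdx_eq_finrank (κ.layer k) (κ.layer j) 𝔓'
    (ramificationIdx_eq_finrank_top (B := K) (F := κ.layer k) (F' := κ.layer j) 𝔓' hfin)

/-- **`A_j ↠ A_k` on the `p`-primary parts `A = Cl[p^∞]`**: every `p`-primary class `b` of `K_k` is the norm of a `p`-primary class of `K_j`
(`a ^ p ^ s = 1`, `p ^ s ∥ h(K_j)`) — the transition maps of `X = lim_← A_k` are onto. [cite: Washington1997, §13.3 (proof of Thm. 13.13: `X → A_n` onto)] -/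
theorem exists_primary_classGroupNorm_layer_layer_eq (hκ : TotallyRamifiedFrom κ 0)
    (v₀ : HeightOneSpectrum (𝓞 K)) (hv₀ : ∀ w : HeightOneSpectrum (𝓞 K), ((p : ℕ) : 𝓞 K) ∈ w.asIdeal → w = v₀)
    [NumberField (κ.layer k)] [NumberField (κ.layer j)] {m : ℕ} {b : ClassGroup (𝓞 (κ.layer k))} (hb : b ^ p ^ m = 1) :
    ∃ a : ClassGroup (𝓞 (κ.layer j)), a ^ p ^ (Fintype.card (ClassGroup (𝓞 (κ.layer j)))).factorization p = 1 ∧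
      classGroupNorm (κ.layer k) (κ.layer j) a = b :=
  exists_primary_preimage_of_surjective _ (classGroupNorm_layer_layer_surjective κ hκ v₀ hv₀) hp.out hb

end Literature.NumberTheory.IwasawaTheory

end
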